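import Summits.QuantumFields.QCD.Theses.PauliWegnerSea
import Summits.QuantumFields.QCD.Theorems.MobilityGap.Negative.LowerPin
import Summits.QuantumFields.QCD.Theorems.SpectralDefectExtinctionWindowExtinctionChessboardTransferFragments

/-!
# `ChiralOneScaleTrajectory` (crux stmt-QuantumFields-17512) — negative-side support: the one-scale quantifiers
# are tight against clause (iii) and `β_k → ∞`

Definition-free extract of the standing disprover's `Cruxes/ChiralOneScaleTrajectory/Disproof.lean` §3
(cdisprove cycle 1), in the vocabulary of `Theorems/MobilityGap/Negative/LowerPin.lean` (`fm`, `bare`; the clause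
texts of the crux are byte-identical to those of `OneScaleTrajectory` / `MobilityGap` (iii)).

The crux `Summit.QuantumFields.QCD.Theses.PauliWegnerSea.ChiralOneScaleTrajectory` asks, for every positive mass
tuple, the ONE-SCALE input `∀ q ∃ K₀ s ∀ᶠ k ∃ ℓ₀ ∈ [1, L_k], ℓ₀ a_k ≤ K₀ (1 + |log a_k|), ℓ₀^q (1+|β_k|)^q · fm(·, s) ≤ 1
on the shell ‖v‖∞ = ℓ₀` together with clause (iii) LOWER `∃ s c₀ C₁ p, c₀ e^{-(C₁ a_k n + p log(n+1))} ≤ fm(n e₀, s)`.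
The two clauses meet on the time axis at the shell point `v = ℓ₀ e₀` of the scheme's own torus `S = L_k`; with a
COMMON exponent `s` elementary bookkeeping (`rpow_le_of_sandwich`) and `β_k → +∞` (two-loop asymptotic scaling,
`N_f ≤ 16`, landed `tendsto_beta_atTop_of_hasAsymptoticScaling`) give:

* `shellDepth_lower_bound_rpow` / `shellDepth_lower_bound` — `max C₁ 0 · K₀ > q − max p 0`: the shell budget
  must grow at least LINEARLY in the demanded power (`∀ q ∃ K₀` cannot be commuted to `∃ K₀ ∀ q`; a restated item
  with a definite power `q₀` must carry `K₀ ≥ (q₀ − p)/C₁`); `shellDepth_of_hasAsymptoticScaling` at crux level;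
* `C₁_pos` — the rate constant of (iii) is POSITIVE in every such witness;
* `not_oneScale_noLog` — with the log factor deleted (`ℓ₀ a_k ≤ K₀`) the one-scale matrix at any power
  `q ≥ max p 1` contradicts (iii): the log room is necessary;
* different exponents: see the companion file `ShellDepthLyapunov.lean` (`fm_le_fm_rpow`, Lyapunov transfer
  `fm(s') ≤ fm(s)^{s'/s}`; `shellDepth_lower_bound_of_exponent_le` — the same bound up to the factor `s₂/s₁`
  whenever the one-scale exponent is at least the exponent of (iii)).
-/

noncomputable section

namespace Summit.QuantumFields.QCD.Theorems.ChiralOneScaleTrajectory.Negative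

open scoped BigOperators Topology
open MeasureTheory Filter Set
open Literature.MathematicalPhysics.QuantumFieldTheory Literature.MathematicalPhysics.QuantumLattice
  Literature.Probability.LatticeModels
open Summit.QuantumFields.QCD.Theorems.MobilityGapNegative

variable {Nf : ℕ}

/-- `ℓ₀ e₀ ∈ box S` for `ℓ₀ ≤ S`. -/
theorem single_mem_box_of_le {ℓ₀ S : ℕ} (h : ℓ₀ ≤ S) : (Pi.single 0 (ℓ₀ : ℤ) : Site 4) ∈ box 4 S := by
  rw [mem_box]
  intro i
  by_cases hi : i = 0
  · subst hi
    simp only [Pi.single_eq_same]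
    exact ⟨by omega, by exact_mod_cast h⟩
  · simp [Pi.single_eq_of_ne hi]

/-- **Pointwise bookkeeping.** From the lower bound `c₀ e^{-(C₁ aℓ + p log(ℓ+1))} ≤ F` and the one-scale
bound `ℓ^r B^r F ≤ 1` (`ℓ ≥ 1`, `B ≥ 0`, `a > 0`, real power `r`):
`B^r ≤ 2^{p⁺} e^{C₁⁺ a ℓ} ℓ^{p⁺ - r} / c₀` (`x⁺ = max x 0`). -/
theorem rpow_le_of_sandwich {c₀ C₁ p a ℓ B F r : ℝ} (hc₀ : 0 < c₀) (ha : 0 < a) (hℓ : 1 ≤ ℓ)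
    (hB : 0 ≤ B) (h1 : c₀ * Real.exp (-(C₁ * (a * ℓ) + p * Real.log (ℓ + 1))) ≤ F)
    (h2 : ℓ ^ r * B ^ r * F ≤ 1) :
    B ^ r ≤ (2 : ℝ) ^ max p 0 * Real.exp (max C₁ 0 * (a * ℓ)) * ℓ ^ (max p 0 - r) / c₀ := by
  have hℓ0 : 0 < ℓ := by linarith
  have hℓ1 : 0 < ℓ + 1 := by linarith
  set E : ℝ := C₁ * (a * ℓ) + p * Real.log (ℓ + 1) with hE
  have hℓr : 0 < ℓ ^ r := Real.rpow_pos_of_pos hℓ0 r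
  have hBr : 0 ≤ B ^ r := Real.rpow_nonneg hB r
  -- `c₀ e^{-E} ℓ^r B^r ≤ 1`
  have h3 : c₀ * Real.exp (-E) * (ℓ ^ r * B ^ r) ≤ 1 := by
    have := mul_le_mul_of_nonneg_left h1 (mul_nonneg hℓr.le hBr)
    calc c₀ * Real.exp (-E) * (ℓ ^ r * B ^ r) = ℓ ^ r * B ^ r * (c₀ * Real.exp (-E)) := by ring
      _ ≤ ℓ ^ r * B ^ r * F := this
      _ ≤ 1 := h2
  -- hence `B^r ≤ e^{E} / (c₀ ℓ^r)`
  have h4 : B ^ r ≤ Real.exp E / (c₀ * ℓ ^ r) := by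
    rw [le_div_iff₀ (by positivity)]
    have e1 : Real.exp E * (c₀ * Real.exp (-E) * (ℓ ^ r * B ^ r)) = B ^ r * (c₀ * ℓ ^ r) := by
      have : Real.exp E * Real.exp (-E) = 1 := by rw [← Real.exp_add, add_neg_cancel, Real.exp_zero]
      calc Real.exp E * (c₀ * Real.exp (-E) * (ℓ ^ r * B ^ r))
          = (Real.exp E * Real.exp (-E)) * (B ^ r * (c₀ * ℓ ^ r)) := by ring
        _ = _ := by rw [this, one_mul]
    have := mul_le_mul_of_nonneg_left h3 (Real.exp_pos E).le
    rwa [e1, mul_one] at this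
  -- bound `e^{E} ≤ e^{C⁺ a ℓ} (2ℓ)^{p⁺} = e^{C⁺ a ℓ} 2^{p⁺} ℓ^{p⁺}`
  have hE1 : Real.exp E ≤ Real.exp (max C₁ 0 * (a * ℓ)) * ((2 : ℝ) ^ max p 0 * ℓ ^ max p 0) := by
    have haℓ : 0 ≤ a * ℓ := by positivity
    rw [hE, Real.exp_add]
    refine mul_le_mul ?_ ?_ (Real.exp_pos _).le (Real.exp_pos _).le
    · exact Real.exp_le_exp.2 (mul_le_mul_of_nonneg_right (le_max_left _ _) haℓ)
    · have e2 : Real.exp (p * Real.log (ℓ + 1)) = (ℓ + 1) ^ p := by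
        rw [Real.rpow_def_of_pos hℓ1, mul_comm]
      rw [e2, ← Real.mul_rpow (by norm_num) hℓ0.le]
      calc (ℓ + 1) ^ p ≤ (ℓ + 1) ^ max p 0 :=
            Real.rpow_le_rpow_of_exponent_le (by linarith) (le_max_left _ _)
        _ ≤ (2 * ℓ) ^ max p 0 := Real.rpow_le_rpow hℓ1.le (by linarith) (le_max_right _ _)
  -- assemble
  calc B ^ r ≤ Real.exp E / (c₀ * ℓ ^ r) := h4
    _ ≤ Real.exp (max C₁ 0 * (a * ℓ)) * ((2 : ℝ) ^ max p 0 * ℓ ^ max p 0) / (c₀ * ℓ ^ r) :=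
        div_le_div_of_nonneg_right hE1 (by positivity)
    _ = (2 : ℝ) ^ max p 0 * Real.exp (max C₁ 0 * (a * ℓ)) * ℓ ^ (max p 0 - r) / c₀ := by
        rw [Real.rpow_sub hℓ0]
        field_simp

/-- **Shell depth lower bound (common exponent, real power `r ≥ 1`).** Along a regularisation with
`β_k → +∞`, if the matrix of (iii) holds with data `(s, c₀, C₁, p)` and the one-scale matrix holds at power `r ≥ 1`
with shell budget `K₀` and the SAME exponent `s`, then `max C₁ 0 · K₀ > r − max p 0`.  (Proof: at the shell point
`ℓ₀ e₀` of the torus `S = L_k`, `rpow_le_of_sandwich` gives `(1+|β_k|)^r ≤ 2^{p⁺} e^{C₁⁺ a_k ℓ₀} ℓ₀^{p⁺-r}/c₀`; if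
`C₁⁺ K₀ ≤ r − p⁺` the right side is `≤ 2^{p⁺} e^{C₁⁺(1+K₀)}/c₀` in both regimes `a_k ℓ₀ ≤ 1` (`ℓ₀^{p⁺-r} ≤ 1`)
and `a_k ℓ₀ > 1` (`e^{C₁⁺ a_k ℓ₀} ℓ₀^{p⁺-r} ≤ e^{C₁⁺K₀} a_k^{r-p⁺-C₁⁺K₀} ≤ e^{C₁⁺K₀}`), contradicting `β_k → ∞`.) -/
theorem shellDepth_lower_bound_rpow (reg : QCDRegularisation Nf) (m : Fin Nf → ℝ)
    (hβ : Tendsto reg.β atTop atTop) (f : Fin Nf) {s c₀ C₁ p K₀ r : ℝ} (hr : 1 ≤ r) (hc₀ : 0 < c₀)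
    (hL : ∀ᶠ k in atTop, ∀ S : ℕ, reg.L k ≤ S → ∀ (f : Fin Nf) (n : ℕ), n ≤ S →
      c₀ * Real.exp (-(C₁ * (reg.a k * n) + p * Real.log (n + 1))) ≤
        fm Nf (reg.β k) (bare reg m k) S f (Pi.single 0 (n : ℤ)) s)
    (hO : ∀ᶠ k in atTop, ∃ ℓ₀ : ℕ, 1 ≤ ℓ₀ ∧ ℓ₀ ≤ reg.L k ∧
      (ℓ₀ : ℝ) * reg.a k ≤ K₀ * (1 + |Real.log (reg.a k)|) ∧ ∀ S : ℕ, reg.L k ≤ S →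
        ∀ (f : Fin Nf) (v : Site 4), v ∈ box 4 S → ‖v‖ = (ℓ₀ : ℝ) →
          (ℓ₀ : ℝ) ^ r * (1 + |reg.β k|) ^ r * fm Nf (reg.β k) (bare reg m k) S f v s ≤ 1) :
    r - max p 0 < max C₁ 0 * K₀ := by
  by_contra hK
  push Not at hK
  set P : ℝ := max p 0 with hP
  set C : ℝ := max C₁ 0 with hC
  have hP0 : 0 ≤ P := le_max_right _ _
  have hC0 : 0 ≤ C := le_max_right _ _
  -- the bound that will contradict `β_k → ∞`
  set M : ℝ := (2 : ℝ) ^ P * Real.exp (C * (1 + |K₀|)) / c₀ with hM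
  have ha1 : ∀ᶠ k in atTop, reg.a k ≤ 1 := reg.tendsto_a.eventually (eventually_le_nhds one_pos)
  have hbig : ∀ᶠ k in atTop, M < reg.β k := hβ.eventually_gt_atTop M
  obtain ⟨k, ⟨⟨⟨hLk, ⟨ℓ₀, hℓ1, hℓL, hℓa, hOk⟩⟩, hak⟩, hβk⟩⟩ := (((hL.and hO).and ha1).and hbig).exists
  have ha := reg.a_pos k
  have hℓ : (1 : ℝ) ≤ ℓ₀ := by exact_mod_cast hℓ1
  have hℓ0 : (0 : ℝ) < ℓ₀ := by linarith
  -- `K₀ > 0` is forced by `0 < ℓ₀ a_k ≤ K₀ (1 + |log a_k|)`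
  have hlog1 : 0 < 1 + |Real.log (reg.a k)| := by positivity
  have hK₀ : 0 < K₀ := by
    have : 0 < K₀ * (1 + |Real.log (reg.a k)|) := lt_of_lt_of_le (by positivity) hℓa
    exact pos_of_mul_pos_left this hlog1.le
  have hKabs : |K₀| = K₀ := abs_of_pos hK₀
  -- the two clause instances at the shell point of the torus `S = L_k`
  have h1 := hLk (reg.L k) le_rfl f ℓ₀ hℓL
  have h2 := hOk (reg.L k) le_rfl f (Pi.single 0 (ℓ₀ : ℤ)) (single_mem_box_of_le hℓL)
    (norm_single_natCast ℓ₀)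
  have hB : (0 : ℝ) ≤ 1 + |reg.β k| := by positivity
  have h3 := rpow_le_of_sandwich hc₀ ha hℓ hB h1 h2
  -- bound the right-hand side by `M` in both regimes
  have hqP : P - r ≤ 0 := by nlinarith [mul_nonneg hC0 hK₀.le]
  have hmain : Real.exp (C * (reg.a k * ℓ₀)) * (ℓ₀ : ℝ) ^ (P - r) ≤ Real.exp (C * (1 + |K₀|)) := by
    rw [hKabs]
    by_cases hx : reg.a k * ℓ₀ ≤ 1
    · -- shallow shell: `e^{C x} ≤ e^{C}`, `ℓ₀^{P-r} ≤ 1`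
      have e1 : Real.exp (C * (reg.a k * ℓ₀)) ≤ Real.exp (C * (1 + K₀)) :=
        Real.exp_le_exp.2 (mul_le_mul_of_nonneg_left (by linarith) hC0)
      have e2 : (ℓ₀ : ℝ) ^ (P - r) ≤ 1 := Real.rpow_le_one_of_one_le_of_nonpos hℓ hqP
      calc Real.exp (C * (reg.a k * ℓ₀)) * (ℓ₀ : ℝ) ^ (P - r)
          ≤ Real.exp (C * (1 + K₀)) * 1 := mul_le_mul e1 e2 (by positivity) (Real.exp_pos _).le
        _ = _ := mul_one _
    · -- deep shell: `ℓ₀ ≥ 1/a_k`, `e^{C x} ≤ e^{C K₀} a_k^{-C K₀}`, `ℓ₀^{P-r} ≤ a_k^{r-P}`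
      push Not at hx
      have hxK : reg.a k * ℓ₀ ≤ K₀ * (1 + |Real.log (reg.a k)|) := by rw [mul_comm]; exact hℓa
      have hloga : |Real.log (reg.a k)| = -Real.log (reg.a k) :=
        abs_of_nonpos (Real.log_nonpos ha.le hak)
      have e1 : Real.exp (C * (reg.a k * ℓ₀)) ≤ Real.exp (C * K₀) * reg.a k ^ (-(C * K₀)) := by
        have : Real.exp (C * (reg.a k * ℓ₀)) ≤ Real.exp (C * (K₀ * (1 + |Real.log (reg.a k)|))) :=
          Real.exp_le_exp.2 (mul_le_mul_of_nonneg_left hxK hC0)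
        refine this.trans (le_of_eq ?_)
        rw [hloga, Real.rpow_def_of_pos ha, ← Real.exp_add]
        congr 1; ring
      have e2 : (ℓ₀ : ℝ) ^ (P - r) ≤ reg.a k ^ (-(P - r)) := by
        have hinv : (reg.a k)⁻¹ ≤ ℓ₀ := by
          rw [inv_le_iff_one_le_mul₀ ha, mul_comm]; exact hx.le
        calc (ℓ₀ : ℝ) ^ (P - r) ≤ (reg.a k)⁻¹ ^ (P - r) :=
              Real.rpow_le_rpow_of_nonpos (inv_pos.2 ha) hinv hqP
          _ = reg.a k ^ (-(P - r)) := by rw [Real.inv_rpow ha.le, ← Real.rpow_neg ha.le]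
      have e3 : reg.a k ^ (-(C * K₀)) * reg.a k ^ (-(P - r)) ≤ 1 := by
        rw [← Real.rpow_add ha]
        exact Real.rpow_le_one ha.le hak (by linarith)
      calc Real.exp (C * (reg.a k * ℓ₀)) * (ℓ₀ : ℝ) ^ (P - r)
          ≤ (Real.exp (C * K₀) * reg.a k ^ (-(C * K₀))) * reg.a k ^ (-(P - r)) :=
            mul_le_mul e1 e2 (Real.rpow_nonneg hℓ0.le _) (by positivity)
        _ = Real.exp (C * K₀) * (reg.a k ^ (-(C * K₀)) * reg.a k ^ (-(P - r))) := by ring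
        _ ≤ Real.exp (C * K₀) * 1 := mul_le_mul_of_nonneg_left e3 (Real.exp_pos _).le
        _ ≤ Real.exp (C * (1 + K₀)) := by
            rw [mul_one]; exact Real.exp_le_exp.2 (by nlinarith)
  have h4 : (1 + |reg.β k|) ^ r ≤ M := by
    calc (1 + |reg.β k|) ^ r ≤ (2 : ℝ) ^ P * Real.exp (C * (reg.a k * ℓ₀)) * (ℓ₀ : ℝ) ^ (P - r) / c₀ := h3
      _ = (2 : ℝ) ^ P * (Real.exp (C * (reg.a k * ℓ₀)) * (ℓ₀ : ℝ) ^ (P - r)) / c₀ := by ring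
      _ ≤ (2 : ℝ) ^ P * Real.exp (C * (1 + |K₀|)) / c₀ :=
          div_le_div_of_nonneg_right (mul_le_mul_of_nonneg_left hmain (by positivity)) hc₀.le
  -- contradiction with `β_k > M`
  have h5 : reg.β k ≤ (1 + |reg.β k|) ^ r :=
    calc reg.β k ≤ 1 + |reg.β k| := by linarith [le_abs_self (reg.β k)]
      _ ≤ (1 + |reg.β k|) ^ r := Real.self_le_rpow_of_one_le (by linarith [abs_nonneg (reg.β k)]) hr
  linarith

/-- **Shell depth lower bound** for the clause as typed (natural power `q ≥ 1`, common exponent):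
`max C₁ 0 · K₀ > q − max p 0`. -/
theorem shellDepth_lower_bound (reg : QCDRegularisation Nf) (m : Fin Nf → ℝ)
    (hβ : Tendsto reg.β atTop atTop) (f : Fin Nf) {s c₀ C₁ p K₀ : ℝ} {q : ℕ} (hq : 1 ≤ q) (hc₀ : 0 < c₀)
    (hL : ∀ᶠ k in atTop, ∀ S : ℕ, reg.L k ≤ S → ∀ (f : Fin Nf) (n : ℕ), n ≤ S →
      c₀ * Real.exp (-(C₁ * (reg.a k * n) + p * Real.log (n + 1))) ≤
        fm Nf (reg.β k) (bare reg m k) S f (Pi.single 0 (n : ℤ)) s)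
    (hO : ∀ᶠ k in atTop, ∃ ℓ₀ : ℕ, 1 ≤ ℓ₀ ∧ ℓ₀ ≤ reg.L k ∧
      (ℓ₀ : ℝ) * reg.a k ≤ K₀ * (1 + |Real.log (reg.a k)|) ∧ ∀ S : ℕ, reg.L k ≤ S →
        ∀ (f : Fin Nf) (v : Site 4), v ∈ box 4 S → ‖v‖ = (ℓ₀ : ℝ) →
          (ℓ₀ : ℝ) ^ q * (1 + |reg.β k|) ^ q * fm Nf (reg.β k) (bare reg m k) S f v s ≤ 1) :
    (q : ℝ) - max p 0 < max C₁ 0 * K₀ := by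
  refine shellDepth_lower_bound_rpow reg m hβ f (r := q) (by exact_mod_cast hq) hc₀ hL ?_
  refine hO.mono fun k ⟨ℓ₀, h1, h2, h3, h4⟩ => ⟨ℓ₀, h1, h2, h3, fun S hS f v hv hn => ?_⟩
  rw [Real.rpow_natCast, Real.rpow_natCast]
  exact h4 S hS f v hv hn

/-- **The rate constant of (iii) is positive** in every such witness: if `C₁ ≤ 0`, the one-scale matrix
fails at every power `q > max p 0` for every budget `K₀` (common exponent). -/
theorem C₁_pos (reg : QCDRegularisation Nf) (m : Fin Nf → ℝ) (hβ : Tendsto reg.β atTop atTop)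
    (f : Fin Nf) {s c₀ C₁ p K₀ : ℝ} {q : ℕ} (hq : 1 ≤ q) (hqp : max p 0 < q) (hc₀ : 0 < c₀)
    (hL : ∀ᶠ k in atTop, ∀ S : ℕ, reg.L k ≤ S → ∀ (f : Fin Nf) (n : ℕ), n ≤ S →
      c₀ * Real.exp (-(C₁ * (reg.a k * n) + p * Real.log (n + 1))) ≤
        fm Nf (reg.β k) (bare reg m k) S f (Pi.single 0 (n : ℤ)) s)
    (hO : ∀ᶠ k in atTop, ∃ ℓ₀ : ℕ, 1 ≤ ℓ₀ ∧ ℓ₀ ≤ reg.L k ∧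
      (ℓ₀ : ℝ) * reg.a k ≤ K₀ * (1 + |Real.log (reg.a k)|) ∧ ∀ S : ℕ, reg.L k ≤ S →
        ∀ (f : Fin Nf) (v : Site 4), v ∈ box 4 S → ‖v‖ = (ℓ₀ : ℝ) →
          (ℓ₀ : ℝ) ^ q * (1 + |reg.β k|) ^ q * fm Nf (reg.β k) (bare reg m k) S f v s ≤ 1) :
    0 < C₁ := by
  have h := shellDepth_lower_bound reg m hβ f hq hc₀ hL hO
  by_contra hC
  push Not at hC
  rw [max_eq_right hC, zero_mul] at h
  linarith

/-- **The log room is necessary.** With the log factor deleted from the shell constraint (`ℓ₀ a_k ≤ K₀`), the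
one-scale matrix at any power `q ≥ max p 1` (common exponent) contradicts (iii) along every regularisation
with `β_k → +∞`: the shell is then at bounded physical depth, where (iii) keeps `fm ≥ c₀ e^{-C₁⁺K₀}(ℓ₀+1)^{-p}`,
while one-scale wants `fm ≤ ℓ₀^{-q} (1+|β_k|)^{-q} → 0`. -/
theorem not_oneScale_noLog (reg : QCDRegularisation Nf) (m : Fin Nf → ℝ) (hβ : Tendsto reg.β atTop atTop)
    (f : Fin Nf) {s c₀ C₁ p : ℝ} {q : ℕ} (hq : 1 ≤ q) (hqp : max p 0 ≤ q) (hc₀ : 0 < c₀)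
    (hL : ∀ᶠ k in atTop, ∀ S : ℕ, reg.L k ≤ S → ∀ (f : Fin Nf) (n : ℕ), n ≤ S →
      c₀ * Real.exp (-(C₁ * (reg.a k * n) + p * Real.log (n + 1))) ≤
        fm Nf (reg.β k) (bare reg m k) S f (Pi.single 0 (n : ℤ)) s) (K₀ : ℝ) :
    ¬ (∀ᶠ k in atTop, ∃ ℓ₀ : ℕ, 1 ≤ ℓ₀ ∧ ℓ₀ ≤ reg.L k ∧ (ℓ₀ : ℝ) * reg.a k ≤ K₀ ∧
      ∀ S : ℕ, reg.L k ≤ S → ∀ (f : Fin Nf) (v : Site 4), v ∈ box 4 S → ‖v‖ = (ℓ₀ : ℝ) →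
        (ℓ₀ : ℝ) ^ q * (1 + |reg.β k|) ^ q * fm Nf (reg.β k) (bare reg m k) S f v s ≤ 1) := by
  intro hO
  set P : ℝ := max p 0 with hP
  set C : ℝ := max C₁ 0 with hC
  have hC0 : 0 ≤ C := le_max_right _ _
  set M : ℝ := (2 : ℝ) ^ P * Real.exp (C * |K₀|) / c₀ with hM
  have hbig : ∀ᶠ k in atTop, M < reg.β k := hβ.eventually_gt_atTop M
  obtain ⟨k, ⟨⟨hLk, ⟨ℓ₀, hℓ1, hℓL, hℓa, hOk⟩⟩, hβk⟩⟩ := ((hL.and hO).and hbig).exists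
  have ha := reg.a_pos k
  have hℓ : (1 : ℝ) ≤ ℓ₀ := by exact_mod_cast hℓ1
  have h1 := hLk (reg.L k) le_rfl f ℓ₀ hℓL
  have h2 := hOk (reg.L k) le_rfl f (Pi.single 0 (ℓ₀ : ℤ)) (single_mem_box_of_le hℓL)
    (norm_single_natCast ℓ₀)
  have hB : (0 : ℝ) ≤ 1 + |reg.β k| := by positivity
  rw [← Real.rpow_natCast, ← Real.rpow_natCast] at h2
  have h3 := rpow_le_of_sandwich hc₀ ha hℓ hB h1 h2
  have hqP : P - q ≤ 0 := by linarith
  have hmain : Real.exp (C * (reg.a k * ℓ₀)) * (ℓ₀ : ℝ) ^ (P - q : ℝ) ≤ Real.exp (C * |K₀|) := by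
    have e1 : Real.exp (C * (reg.a k * ℓ₀)) ≤ Real.exp (C * |K₀|) := by
      refine Real.exp_le_exp.2 (mul_le_mul_of_nonneg_left ?_ hC0)
      calc reg.a k * ℓ₀ = (ℓ₀ : ℝ) * reg.a k := mul_comm _ _
        _ ≤ K₀ := hℓa
        _ ≤ |K₀| := le_abs_self _
    have e2 : (ℓ₀ : ℝ) ^ (P - q : ℝ) ≤ 1 := Real.rpow_le_one_of_one_le_of_nonpos hℓ hqP
    calc Real.exp (C * (reg.a k * ℓ₀)) * (ℓ₀ : ℝ) ^ (P - q : ℝ) ≤ Real.exp (C * |K₀|) * 1 :=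
        mul_le_mul e1 e2 (by positivity) (Real.exp_pos _).le
      _ = _ := mul_one _
  have h4 : (1 + |reg.β k|) ^ (q : ℝ) ≤ M := by
    calc (1 + |reg.β k|) ^ (q : ℝ) ≤ (2 : ℝ) ^ P * Real.exp (C * (reg.a k * ℓ₀)) * (ℓ₀ : ℝ) ^ (P - q : ℝ) / c₀ := h3
      _ = (2 : ℝ) ^ P * (Real.exp (C * (reg.a k * ℓ₀)) * (ℓ₀ : ℝ) ^ (P - q : ℝ)) / c₀ := by ring
      _ ≤ (2 : ℝ) ^ P * Real.exp (C * |K₀|) / c₀ :=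
          div_le_div_of_nonneg_right (mul_le_mul_of_nonneg_left hmain (by positivity)) hc₀.le
  have h5 : reg.β k ≤ (1 + |reg.β k|) ^ (q : ℝ) :=
    calc reg.β k ≤ 1 + |reg.β k| := by linarith [le_abs_self (reg.β k)]
      _ ≤ (1 + |reg.β k|) ^ (q : ℝ) :=
          Real.self_le_rpow_of_one_le (by linarith [abs_nonneg (reg.β k)]) (by exact_mod_cast hq)
  linarith

/-- **Crux-level corollary.** Along any regularisation of `N_f ∈ {2,3}`-flavour lattice QCD with two-loop
asymptotic scaling (a conjunct of the crux), for every mass tuple and every data `(s, c₀, C₁, p)` of (iii): if the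
one-scale clause at power `q ≥ 1` is met with budget `K₀` AT THE EXPONENT OF (iii), then `C₁⁺ K₀ > q − p⁺`. -/
theorem shellDepth_of_hasAsymptoticScaling {Nf : ℕ} (hNf : Nf = 2 ∨ Nf = 3) (reg : QCDRegularisation Nf)
    (hAS : (reg.scheme 0 0 0).HasAsymptoticScaling) (m : Fin Nf → ℝ) {s c₀ C₁ p K₀ : ℝ} {q : ℕ} (hq : 1 ≤ q)
    (hc₀ : 0 < c₀)
    (hL : ∀ᶠ k in atTop, ∀ S : ℕ, reg.L k ≤ S → ∀ (f : Fin Nf) (n : ℕ), n ≤ S →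
      c₀ * Real.exp (-(C₁ * (reg.a k * n) + p * Real.log (n + 1))) ≤
        fm Nf (reg.β k) (bare reg m k) S f (Pi.single 0 (n : ℤ)) s)
    (hO : ∀ᶠ k in atTop, ∃ ℓ₀ : ℕ, 1 ≤ ℓ₀ ∧ ℓ₀ ≤ reg.L k ∧
      (ℓ₀ : ℝ) * reg.a k ≤ K₀ * (1 + |Real.log (reg.a k)|) ∧ ∀ S : ℕ, reg.L k ≤ S →
        ∀ (f : Fin Nf) (v : Site 4), v ∈ box 4 S → ‖v‖ = (ℓ₀ : ℝ) →
          (ℓ₀ : ℝ) ^ q * (1 + |reg.β k|) ^ q * fm Nf (reg.β k) (bare reg m k) S f v s ≤ 1) :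
    (q : ℝ) - max p 0 < max C₁ 0 * K₀ := by
  have hNf16 : Nf ≤ 16 := by rcases hNf with rfl | rfl <;> norm_num
  have hNf0 : 0 < Nf := by rcases hNf with rfl | rfl <;> norm_num
  exact shellDepth_lower_bound reg m
    (Summit.QuantumFields.QCD.Cruxes.WindowExtinction.ChessboardColdCells.tendsto_beta_atTop_of_hasAsymptoticScaling
      hNf16 reg hAS) ⟨0, hNf0⟩ hq hc₀ hL hO

end Summit.QuantumFields.QCD.Theorems.ChiralOneScaleTrajectory.Negative

end
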